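import Mathlib.Algebra.Homology.ShortComplex.Ab
import Mathlib.Algebra.Homology.ShortComplex.ExactFunctor
import Mathlib.Algebra.Homology.ShortComplex.PreservesHomology
import Mathlib.CategoryTheory.Abelian.FunctorCategory
import Mathlib.CategoryTheory.Sites.Abelian
import Mathlib.CategoryTheory.Sites.Limits
import HarnessLib

/-!
# Exactness of a short complex of abelian sheaves from sectionwise exactness

A short complex `F₁ → F₂ → F₃` of sheaves of abelian groups on a site is exact (in the abelian
category of sheaves) as soon as the complexes of sections `F₁(U) → F₂(U) → F₃(U)` are exact for
every object `U` — i.e. every section of `F₂` killed by `g` is, over the *same* `U`, the image of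
a section of `F₁` (no refinement of `U` needed). This is the trivial direction of "exactness of
sheaves is local" (Milne II Thm. 2.15: (a) "`a : P(X_E) → S(X_E)` is exact", (b) "`0 → F' → F →
F''` is exact in `S(X_E)`" iff "in `P(X_E)`" iff "`0 → F'(U) → F(U) → F''(U)` is exact for all
`U`"; here we only use: exact as presheaves ⇒ exact as sheaves, because `a` is exact and
restricts to the identity on sheaves). Proved:

* `presheaf_exact_of_sections` : for presheaves of abelian groups, sectionwise exact ⇒ exact
  (homology in a functor category is computed objectwise, Mathlib `ShortComplex.mapHomologyIso`
  with `evaluation`, and `ShortComplex.ab_exact_iff`);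
* `sheaf_exact_of_sections` : for sheaves, sectionwise exact ⇒ exact (apply the exact functor
  `presheafToSheaf`, Mathlib `ShortComplex.Exact.map`, and the counit isomorphism
  `sheafToPresheaf ⋙ presheafToSheaf ≅ 𝟭`).

Used for the exactness in the middle of the Artin–Schreier sequence on `Y_ét`
(`EtaleArtinSchreier*.lean`).

## References

* J. S. Milne, *Étale cohomology*, Princeton (reissue 2025; held copy, PDF pages): II Thm. 2.11
  (associated sheaf), II Thm. 2.15 (a), (b) (pp. 70–71). [Milne2025]

## Design notes

* Stated for `AddCommGrpCat.{w}`-valued (pre)sheaves on any site `(C, J)` with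
  `HasSheafify J AddCommGrpCat.{w}`; nothing specific to schemes.
* Mathlib searches: no `ShortComplex.Exact` criterion for functor categories or sheaf categories
  (`exact_iff_evaluation`, "objectwise") was found; `Functor.isZero_iff`, `mapHomologyIso`,
  `Exact.map`, `exact_of_iso`, `mapNatIso` are Mathlib's. Nothing restated.
-/

universe w v u

open CategoryTheory Limits Opposite

namespace Literature.AlgebraicGeometry.Motives

variable {C : Type u} [Category.{v} C]

/-- **Sectionwise exact ⇒ exact, for presheaves of abelian groups**: if for every `U` every
`x₂ ∈ F₂(U)` with `g(x₂) = 0` is `f(x₁)` for some `x₁ ∈ F₁(U)`, then `F₁ → F₂ → F₃` is exact in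
`Cᵒᵖ ⥤ Ab` (homology of presheaves is computed objectwise). [folklore] -/
theorem presheaf_exact_of_sections (T : ShortComplex (Cᵒᵖ ⥤ AddCommGrpCat.{w}))
    (h : ∀ (U : Cᵒᵖ) (x₂ : T.X₂.obj U), T.g.app U x₂ = 0 → ∃ x₁, T.f.app U x₁ = x₂) :
    T.Exact := by
  rw [ShortComplex.exact_iff_isZero_homology, Functor.isZero_iff]
  intro U
  refine IsZero.of_iso ?_ (T.mapHomologyIso ((evaluation Cᵒᵖ AddCommGrpCat.{w}).obj U)).symm
  rw [← ShortComplex.exact_iff_isZero_homology, ShortComplex.ab_exact_iff]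
  exact h U

variable (J : GrothendieckTopology C) [HasSheafify J AddCommGrpCat.{w}]

/-- **Sectionwise exact ⇒ exact, for sheaves of abelian groups** (Milne II Thm. 2.15 (a), (b),
easy direction): if for every `U` every section `x₂ ∈ F₂(U)` with `g(x₂) = 0` is `f(x₁)` for some
`x₁ ∈ F₁(U)`, then `F₁ → F₂ → F₃` is exact in the abelian category `Sheaf J Ab` (the underlying
complex of presheaves is exact, sheafification `a` is exact, and `a ∘ (forget) ≅ id` on sheaves).
[cite: Milne2025, II Thm. 2.15 (a), (b)] -/
theorem sheaf_exact_of_sections (S : ShortComplex (Sheaf J AddCommGrpCat.{w}))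
    (h : ∀ (U : Cᵒᵖ) (x₂ : S.X₂.obj.obj U), S.g.hom.app U x₂ = 0 →
      ∃ x₁, S.f.hom.app U x₁ = x₂) : S.Exact := by
  have hT : (S.map (sheafToPresheaf J AddCommGrpCat.{w})).Exact :=
    presheaf_exact_of_sections _ h
  have h2 := hT.map (presheafToSheaf J AddCommGrpCat.{w})
  exact ShortComplex.exact_of_iso
    (S.mapNatIso (asIso (sheafificationAdjunction J AddCommGrpCat.{w}).counit)) h2

end Literature.AlgebraicGeometry.Motives
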